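import Summits.AtomisticToContinuum.HydrodynamicLimit.Theorems.JaynesSqueezeBlockGibbsToRelEntropyLedger
import Summits.AtomisticToContinuum.HydrodynamicLimit.Theorems.JaynesSqueezeBlockGibbsBlockReference
import Summits.AtomisticToContinuum.HydrodynamicLimit.Theorems.JaynesSqueezeSqueezeToBlockGibbsPinning
import Literature.MathematicalPhysics.KineticTheory.HardSphereEuler
import Literature.Analysis.FunctionSpaces.TorusSpaceTime
import HarnessLib

/-!
# Crux `ClampedCurrentsDock` (stmt-AtomisticToContinuum-14680), line `IdeatorTwoSketch`:
# S7a — the a-priori entropy bound along the explicit reference family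

Helper file (`--supports stmt-AtomisticToContinuum-14680`) for the registered skeleton
`Cruxes/ClampedCurrentsDock/Lines/IdeatorTwoSketch.lean` (stub `stub_ledgerApriori : LedgerAprioriBound`, clause (i)
of the integrated ledger `LedgerIntegralCore`). With the initial local Gibbs law `λ_N = localGibbsLaw σ a₀ u₀ θ₀ N Φ`
and the time-dependent reference `ψ_s = localGibbsLaw σ (ρ_s·Rf(σ³ρ_s)) (u s) (θ s) N Φ` built on a classical
hard-sphere Euler solution `(ρ, u, θ)` on `[0, T)`, the relative entropies `H_N(s) = KL(lawAt Φ λ_N s ‖ ψ_s)`,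
`s ∈ [0, t]`, `t < T`, are bounded by ONE real number (depending on `N`, `Φ` and the data, not on `s`).

Proof (finite `N`, all ingredients landed in the tree):

* `klDiv_lawAt_localGibbsLaw_le_of_bounds` — for references `(b, w, ϑ)` in a compact parameter range
  `A⁻¹ ≤ b ≤ A`, `Θ⁻¹ ≤ ϑ ≤ Θ`, `‖w‖ ≤ V` the entropy `KL(lawAt Φ λ_N s ‖ localGibbsLaw σ b w ϑ N Φ)` is bounded
  uniformly in the reference AND in the time `s`: the exact bookkeeping
  `JaynesSqueezeClosure.toReal_klDiv_lawAt_localGibbsLaw_eq`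
  (`KL = (N+1)(E_λ⟨emp z, log prof₀⟩ − E_λ⟨emp Φ_s z, log prof_{b,w,ϑ}⟩) + log Z_{b,w,ϑ} − log Z₀`), the log-profile
  pairing bound `BlockGibbsLine.integrable_logPair_comp_of_bounds` with its explicit constant `C(A, Θ, V)`,
  conservation of the kinetic energy along the flow (`HardSphereFlow.configEnergy_flow`: the time-`s` kinetic pairing
  has the time-`0` mean), `canonicalPartition = posPartition` and the log-partition comparison
  `BlockGibbsLine.abs_log_posPartition_sub_le` against the constant activity `1`;
* `stub_ledgerApriori` — the Euler profiles on `[0, t]` lie in such a range: joint smoothness gives uniform upper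
  bounds (`Torus.IsSmoothSpaceTimeOn.exists_norm_le_of_isCompact`) and positive lower bounds
  (`JaynesSqueezeSqueeze.exists_pos_le_of_isSmoothSpaceTimeOn`) on the compact `[0, t] × 𝕋³`, and with `Rf ∈ [1, 2]`
  on `[0, r]` and the packing `σ³ρ_s < r` the activity `ρ_s Rf(σ³ρ_s)` is continuous with values in `[ρ_min, 2ρ_max]`.

No new objects; the only `def` is the registered stub signature `LedgerAprioriBound` (verbatim from the skeleton).
-/

noncomputable section

namespace Summit.AtomisticToContinuum.HydrodynamicLimit.Theorems.ClampedCurrentsDockApriori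

open scoped BigOperators ENNReal Classical
open MeasureTheory Filter Set Topology InformationTheory
open Literature.MathematicalPhysics.KineticTheory Literature.Analysis.FluidPDE Literature.Analysis.FunctionSpaces

/-- **S7a — the a-priori entropy bound along the explicit reference family** (registered stub signature
`stub_ledgerApriori` of line `IdeatorTwoSketch`, crux `ClampedCurrentsDock`; clause (i) of `LedgerIntegralCore`).
For an insertion factor `Rf` continuous on `[0, r]` with values in `[1, 2]`, continuous positive initial profiles,
`0 < σ < 1/2`, a classical hs-Euler solution on `[0, T)`, `t ∈ (0, T)` with packing `ρ_s σ³ < r` on `[0, t]`,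
every `N` and every flow: the relative entropies `KL(lawAt Φ λ_N s ‖ localGibbsLaw σ (ρ_s·Rf(σ³ρ_s)) (u s) (θ s))`,
`s ∈ [0, t]`, are bounded by one real `B` (depending on `N`). Route-internal stub signature, not a cited fact. -/
def LedgerAprioriBound : Prop :=
  ∀ (r : ℝ) (Rf : ℝ → ℝ), 0 < r → (∀ x ∈ Icc 0 r, 1 ≤ Rf x ∧ Rf x ≤ 2) → ContinuousOn Rf (Icc 0 r) →
    ∀ (a₀ θ₀ : T3 → ℝ) (u₀ : T3 → V3), Continuous a₀ → Continuous θ₀ → Continuous u₀ →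
      (∀ x, 0 < a₀ x) → (∀ x, 0 < θ₀ x) →
      ∀ σ : ℝ, 0 < σ → σ < 1 / 2 →
        ∀ (T : ℝ) (ρ θ : ℝ → T3 → ℝ) (u : ℝ → T3 → V3), IsHardSphereEulerSolution σ T ρ u θ →
          ∀ t ∈ Set.Ioo 0 T, (∀ s ∈ Set.Icc 0 t, ∀ x, ρ s x * σ ^ 3 < r) →
            ∀ (N : ℕ) (Φ : HardSphereFlow (Torus.geometry (Fin 3)) (hsDiameter σ N) (N + 1)),
              ∃ B : ℝ, ∀ s ∈ Set.Icc 0 t,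
                klDiv (Φ.lawAt (localGibbsLaw σ a₀ u₀ θ₀ N Φ) s)
                  (localGibbsLaw σ (fun x => ρ s x * Rf (σ ^ 3 * ρ s x)) (u s) (θ s) N Φ) ≤ ENNReal.ofReal B

/-! ## Uniform entropy bound over references in a compact parameter range -/

section Reference

variable {σ : ℝ} {a₀ θ₀ : T3 → ℝ} {u₀ : T3 → V3}

/-- **A-priori bound of the relative entropy of the evolved local Gibbs law with respect to local Gibbs references in
a compact parameter range, uniform in time.** For `0 < σ < 1/2`, continuous positive `(a₀, u₀, θ₀)`, `N`, a flow `Φ`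
and `A, Θ > 0` there is `B` with `KL(lawAt Φ λ_N s ‖ localGibbsLaw σ b w ϑ N Φ) ≤ B` for every time `s` and all
continuous references with `A⁻¹ ≤ b ≤ A`, `Θ⁻¹ ≤ ϑ ≤ Θ`, `‖w‖ ≤ V`. Exact finite-`N` bookkeeping
(`toReal_klDiv_lawAt_localGibbsLaw_eq`), the log-profile pairing bound with the explicit constant `C(A, Θ, V)`
(`integrable_logPair_comp_of_bounds`), conservation of the kinetic energy along the flow, and the log-partition
comparison with the constant activity `1`. [cite: Yau1991, §2] -/
theorem klDiv_lawAt_localGibbsLaw_le_of_bounds (hσ : 0 < σ) (hσ2 : σ < 1 / 2) (ha : Continuous a₀)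
    (hθ : Continuous θ₀) (hu : Continuous u₀) (ha0 : ∀ x, 0 < a₀ x) (hθ0 : ∀ x, 0 < θ₀ x) (N : ℕ)
    (Φ : HardSphereFlow (Torus.geometry (Fin 3)) (hsDiameter σ N) (N + 1)) {A Θ : ℝ} (V : ℝ) (hA : 0 < A)
    (hΘ : 0 < Θ) :
    ∃ B : ℝ, ∀ (b ϑ : T3 → ℝ) (w : T3 → V3), Continuous b → Continuous ϑ → Continuous w →
      (∀ x, A⁻¹ ≤ b x ∧ b x ≤ A) → (∀ x, Θ⁻¹ ≤ ϑ x ∧ ϑ x ≤ Θ) → (∀ x, ‖w x‖ ≤ V) → ∀ s : ℝ,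
        klDiv (Φ.lawAt (localGibbsLaw σ a₀ u₀ θ₀ N Φ) s) (localGibbsLaw σ b w ϑ N Φ) ≤ ENNReal.ofReal B := by
  have hσ2' : σ ≤ 1 / 2 := hσ2.le
  have hσ2'' : σ < 2⁻¹ := by rwa [one_div] at hσ2
  haveI := isProbabilityMeasure_localGibbsLaw ha hθ hu ha0 hθ0 hσ2' N Φ
  set P := localGibbsLaw σ a₀ u₀ θ₀ N Φ with hP
  set I₀ : ℝ := ∫ z, (∫ y, Real.log (localGibbsProfile a₀ u₀ θ₀ y) ∂(empiricalMeasure z)) ∂P with hI₀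
  set K₀ : ℝ := ∫ z, (∫ y, ‖y.2‖ ^ 2 ∂(empiricalMeasure z)) ∂P with hK₀
  set C : ℝ := Real.log A + 3 / 2 * (Real.log (2 * Real.pi) + Real.log Θ) + Θ * (1 + V ^ 2) with hC
  set Z₀ : ℝ := canonicalPartition (Torus.geometry (Fin 3)) (hsDiameter σ N) (N + 1)
    (localGibbsProfile a₀ u₀ θ₀) with hZ₀
  set Z₁ : ℝ := posPartition (fun _ : T3 => (1 : ℝ)) (hsDiameter σ N) (N + 1) with hZ₁
  refine ⟨((N : ℝ) + 1) * (I₀ + C * (1 + K₀)) + (|Real.log Z₁| + ((N : ℝ) + 1) * Real.log A) - Real.log Z₀,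
    ?_⟩
  intro b ϑ w hb hϑ hw hbA hϑΘ hwV s
  have hb0 : ∀ x, 0 < b x := fun x => (inv_pos.2 hA).trans_le (hbA x).1
  have hϑ0 : ∀ x, 0 < ϑ x := fun x => (inv_pos.2 hΘ).trans_le (hϑΘ x).1
  have hne := JaynesSqueezeClosure.klDiv_lawAt_localGibbsLaw_ne_top hσ2' ha hθ hu ha0 hθ0 hb hϑ hw hb0 hϑ0 N Φ s
  rw [← ENNReal.ofReal_toReal hne]
  refine ENNReal.ofReal_le_ofReal ?_
  rw [JaynesSqueezeClosure.toReal_klDiv_lawAt_localGibbsLaw_eq hσ hσ2'' ha hθ hu ha0 hθ0 hb hϑ hw hb0 hϑ0 N Φ s]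
  -- the time-`s` pairing: explicit constant times (mass + conserved kinetic energy)
  have hKs := JaynesSqueezeSqueeze.integrable_kineticPair_flow_localGibbsLaw hσ2' ha hθ hu ha0 hθ0 N Φ s
  obtain ⟨-, hIs⟩ := BlockGibbsLine.integrable_logPair_comp_of_bounds hA hΘ hb.measurable hϑ.measurable
    hw.measurable hbA hϑΘ hwV (Φ.measurable_flow s) hKs
  have hKeq : ∫ z, (∫ y, ‖y.2‖ ^ 2 ∂(empiricalMeasure (Φ.flow s z))) ∂P = K₀ := by
    refine integral_congr_ae ?_
    have hac : P ≪ liouville (Torus.geometry (Fin 3)) (N + 1) (hsDiameter σ N) := by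
      rw [hP, localGibbsLaw, particleLaw_eq]; exact withDensity_absolutelyContinuous _ _
    filter_upwards [hac.ae_le Φ.ae_mem_good] with z hz
    rw [JaynesSqueezeSqueeze.kineticPair_eq_configEnergy, JaynesSqueezeSqueeze.kineticPair_eq_configEnergy,
      Φ.configEnergy_flow hz s]
  rw [hKeq, probReal_univ] at hIs
  have h1 : -(C * (1 + K₀)) ≤
      ∫ z, (∫ y, Real.log (localGibbsProfile b w ϑ y) ∂(empiricalMeasure (Φ.flow s z))) ∂P :=
    (abs_le.1 hIs).1
  -- the partition function of the reference: comparison with the constant activity `1`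
  have hZ : canonicalPartition (Torus.geometry (Fin 3)) (hsDiameter σ N) (N + 1) (localGibbsProfile b w ϑ) =
      posPartition b (hsDiameter σ N) (N + 1) :=
    canonicalPartition_eq_posPartition hb hϑ hw (fun x => (hb0 x).le) hϑ0 _ _
  have hlog : ∀ x, |Real.log (b x) - Real.log ((fun _ : T3 => (1 : ℝ)) x)| ≤ Real.log A := fun x => by
    simp only [Real.log_one, sub_zero]
    exact BlockGibbsLine.abs_log_le_log_of_bounds hA (hbA x).1 (hbA x).2
  have hA1 : 1 ≤ A := BlockGibbsLine.one_le_of_inv_le_of_le hA (hbA 0).1 (hbA 0).2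
  have hZ1 := BlockGibbsLine.abs_log_posPartition_sub_le hb.measurable measurable_const hb0 (fun _ => one_pos)
    (fun x => (hbA x).2) (fun _ => hA1) hlog hσ2' N
  rw [hZ]
  -- combine
  have h2 := (abs_le.1 hZ1).2
  have h3 : ((N : ℝ) + 1) *
      (I₀ - ∫ z, (∫ y, Real.log (localGibbsProfile b w ϑ y) ∂(empiricalMeasure (Φ.flow s z))) ∂P) ≤
      ((N : ℝ) + 1) * (I₀ + C * (1 + K₀)) :=
    mul_le_mul_of_nonneg_left (by linarith) (by positivity)
  linarith [le_abs_self (Real.log Z₁)]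

end Reference

/-! ## The stub -/

/-- **STUB S7a `stub_ledgerApriori` of line `IdeatorTwoSketch` (crux `ClampedCurrentsDock`, stmt-14680): the a-priori
entropy bound along the explicit reference family.** On `[0, t] ⊂ [0, T)` the Euler profiles are jointly continuous,
hence `ρ_min ≤ ρ_s ≤ ρ_max`, `θ_min ≤ θ_s ≤ θ_max`, `‖u_s‖ ≤ V` with positive `ρ_min, θ_min`
(`Torus.IsSmoothSpaceTimeOn.exists_norm_le_of_isCompact`, `JaynesSqueezeSqueeze.exists_pos_le_of_isSmoothSpaceTimeOn`);
with `Rf ∈ [1, 2]`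
on `[0, r]` and the packing `σ³ρ_s < r` the activity `ρ_s Rf(σ³ρ_s)` is continuous with values in `[ρ_min, 2ρ_max]`, so
every reference of the family lies in one compact parameter range and `klDiv_lawAt_localGibbsLaw_le_of_bounds` applies.
[cite: Yau1991, §2] -/
theorem stub_ledgerApriori : LedgerAprioriBound := by
  intro r Rf _hr hbd hcont a₀ θ₀ u₀ ha hθ hu ha0 hθ0 σ hσ hσ2 T ρ θ u hE t ht hpack N Φ
  have htT : t ∈ Ico 0 T := ⟨ht.1.le, ht.2⟩
  have hsub : Icc 0 t ⊆ Ico 0 T := Icc_subset_Ico_right ht.2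
  -- uniform bounds of the Euler profiles on `[0, t] × 𝕋³`
  obtain ⟨R, hR⟩ := hE.smooth_density.exists_norm_le_of_isCompact isCompact_Icc hsub
  obtain ⟨U, hU⟩ := hE.smooth_velocity.exists_norm_le_of_isCompact isCompact_Icc hsub
  obtain ⟨Θ₁, hΘ₁⟩ := hE.smooth_temperature.exists_norm_le_of_isCompact isCompact_Icc hsub
  obtain ⟨ρm, hρm, hρml⟩ :=
    JaynesSqueezeSqueeze.exists_pos_le_of_isSmoothSpaceTimeOn hE.smooth_density hE.density_pos htT
  obtain ⟨θm, hθm, hθml⟩ :=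
    JaynesSqueezeSqueeze.exists_pos_le_of_isSmoothSpaceTimeOn hE.smooth_temperature hE.temperature_pos htT
  -- one compact parameter range for the whole reference family
  set A : ℝ := 2 * R + ρm⁻¹ with hA
  set Θ : ℝ := Θ₁ + θm⁻¹ with hΘ
  have hR0 : 0 ≤ R := (norm_nonneg _).trans (hR 0 ⟨le_rfl, ht.1.le⟩ 0)
  have hΘ₁0 : 0 ≤ Θ₁ := (norm_nonneg _).trans (hΘ₁ 0 ⟨le_rfl, ht.1.le⟩ 0)
  have hA0 : 0 < A := by positivity
  have hΘ0 : 0 < Θ := by positivity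
  obtain ⟨B, hB⟩ := klDiv_lawAt_localGibbsLaw_le_of_bounds hσ hσ2 ha hθ hu ha0 hθ0 N Φ U hA0 hΘ0
  refine ⟨B, fun s hs => ?_⟩
  have hsT : s ∈ Ico 0 T := hsub hs
  -- the time-`s` profiles
  have hρc : Continuous (ρ s) := (hE.smooth_density.isSmooth_slice hsT).continuous
  have huc : Continuous (u s) := (hE.smooth_velocity.isSmooth_slice hsT).continuous
  have hθc : Continuous (θ s) := (hE.smooth_temperature.isSmooth_slice hsT).continuous
  have hρ0 : ∀ x, 0 < ρ s x := hE.density_pos s hsT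
  have harg : ∀ x, σ ^ 3 * ρ s x ∈ Icc 0 r := fun x =>
    ⟨(mul_pos (pow_pos hσ 3) (hρ0 x)).le, by rw [mul_comm]; exact (hpack s hs x).le⟩
  have hbc : Continuous fun x => ρ s x * Rf (σ ^ 3 * ρ s x) :=
    hρc.mul (hcont.comp_continuous (continuous_const.mul hρc) harg)
  refine hB (fun x => ρ s x * Rf (σ ^ 3 * ρ s x)) (θ s) (u s) hbc hθc huc (fun x => ?_) (fun x => ?_)
    (fun x => hU s hs x) s
  · -- `A⁻¹ ≤ ρ_s Rf(σ³ρ_s) ≤ A`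
    have hRf := hbd _ (harg x)
    have hρx : ρ s x ≤ R := (le_abs_self _).trans ((Real.norm_eq_abs _).symm.le.trans (hR s hs x))
    have hρmx : ρm ≤ ρ s x := hρml s hs x
    constructor
    · calc A⁻¹ ≤ ρm := by
            rw [inv_le_comm₀ hA0 hρm, hA]
            exact le_add_of_nonneg_left (by positivity)
        _ ≤ ρ s x * Rf (σ ^ 3 * ρ s x) := by
            calc ρm ≤ ρ s x * 1 := by rw [mul_one]; exact hρmx
              _ ≤ ρ s x * Rf (σ ^ 3 * ρ s x) := mul_le_mul_of_nonneg_left hRf.1 (hρ0 x).le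
    · calc ρ s x * Rf (σ ^ 3 * ρ s x) ≤ R * 2 :=
            mul_le_mul hρx hRf.2 (zero_le_one.trans hRf.1) hR0
        _ ≤ A := by rw [hA, mul_comm]; exact le_add_of_nonneg_right (by positivity)
  · -- `Θ⁻¹ ≤ θ_s ≤ Θ`
    have hθx : θ s x ≤ Θ₁ := (le_abs_self _).trans ((Real.norm_eq_abs _).symm.le.trans (hΘ₁ s hs x))
    have hθmx : θm ≤ θ s x := hθml s hs x
    constructor
    · calc Θ⁻¹ ≤ θm := by
            rw [inv_le_comm₀ hΘ0 hθm, hΘ]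
            exact le_add_of_nonneg_left hΘ₁0
        _ ≤ θ s x := hθmx
    · exact hθx.trans (le_add_of_nonneg_right (by positivity))

end Summit.AtomisticToContinuum.HydrodynamicLimit.Theorems.ClampedCurrentsDockApriori

end
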